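import Summits.ResolutionOfSingularities.ResolutionOfSingularities.Theorems.RisoStrataRisoCentresResolveHeightOneStep
import Summits.ResolutionOfSingularities.ResolutionOfSingularities.Theorems.RisoStrataRisoCentresResolveHeightOneReach
import Summits.ResolutionOfSingularities.ResolutionOfSingularities.Theorems.RisoStrataRisoCentresResolveHeightOneLU

/-!
# Route RisoStrata — crux `RisoCentresResolve` (stmt-ResolutionOfSingularities-18546), line `Sketch`:
# valuations with ONE-DIMENSIONAL centre are uniformized by the top word, in every transcendence degree

A reusable tool for the open core of the crux (Monreal, arXiv:2606.12554, Question 1.6 in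
characteristic `p`, local-uniformization form in transcendence degree `≥ 2`): along the constant
top word (every letter `≥ N` blows up the whole reduced singular locus, `hidden_cut_of_le`), a
valuation ring `O ⊇ k` whose centre on a chart `k[hᵢ/hⱼ] ⊆ O` has a local ring of Krull dimension
`≤ 1` — the generic point, or a codimension-one point such as a branch of the surface at the
generic point of a singular curve — is uniformized after finitely many admissible riso steps. So
the difficulty of the core is concentrated at valuations centred at points of codimension `≥ 2`
(for surfaces: at closed points). Composition (`rcr_heightOneLU`) of the three landed cycle-2 stubs
of line `Sketch`: `stub_rcrHeightOneStep` (p157633: when the centre ideal lies in the centre of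
`O` and the local ring there has dimension `≤ 1`, the riso step localised at the centre IS the
quadratic transform along `O` — the centre is a minimal prime of the radical ideal `Cen`),
`stub_rcrHeightOneReach` (p157670: quadratic sequences of a one-dimensional local ring of an affine
`k`-domain along `O ≠ K` reach `O`, a DVR — Krull–Akizuki over the local ring, E. Noether
finiteness, Herrmann–Ikeda–Orbanz (30.2)), `stub_rcrHeightOneLU` (p157607: dimension `≤ 1`
persists along the tower by Krull–Akizuki; at a singular stage the top-letter centre ideal lies in
the centre of `O` by openness of the regular locus and the Jacobson property; an everywhere
singular tower would be an infinite quadratic sequence reaching the regular `O`).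
-/

noncomputable section

set_option linter.dupNamespace false -- mandated namespace of this single-conjunct summit

namespace Summit.ResolutionOfSingularities.ResolutionOfSingularities.Theorems

open Summit.ResolutionOfSingularities.ResolutionOfSingularities.Theses.RisoStrata
open Literature.AlgebraicGeometry.Resolution

/-- **Height-one local uniformization along the top word, every dimension.** For a cut predicate
`P` holding at every maximal ideal at the level `N` (the top letter), a projective presentation
`K = k(hᵢ/hⱼ)` by `N + 1` nonzero elements over an algebraically closed field (of ANY transcendence
degree) and a valuation ring `O ⊇ k` of `K` such that some chart `k[hᵢ/hⱼ₀]` lies in `O` with a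
local ring at the centre of `O` of Krull dimension `≤ 1`, some admissible chart path of the constant
top word reaches a regular local ring at the centre of `O` after finitely many steps. Glue of the
landed stubs `stub_rcrHeightOneLU`, `stub_rcrHeightOneStep`, `stub_rcrHeightOneReach`. [folklore] -/
theorem rcr_heightOneLU {k K : Type} [Field k] [IsAlgClosed k] [Field K] [Algebra k K]
    (P : ∀ B : Subalgebra k K, Ideal ↥B → ℕ → Prop) (N : ℕ)
    (hP : ∀ (B : Subalgebra k K) (m : Ideal ↥B), m.IsMaximal → P B m N)
    (h : Fin (N + 1) → K) (hh : ∀ i, h i ≠ 0)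
    (hgen : IntermediateField.adjoin k
      (Set.range fun ij : Fin (N + 1) × Fin (N + 1) => h ij.1 * (h ij.2)⁻¹) = ⊤)
    (O : ValuationSubring K) (hk : ∀ c : k, algebraMap k K c ∈ O)
    (j₀ : Fin (N + 1)) (hj₀ : ∀ i, h i * (h j₀)⁻¹ ∈ O)
    (hdim : ringKrullDim ↥(risoLoc O (Algebra.adjoin k (Set.range fun i => h i * (h j₀)⁻¹))) ≤ 1) :
    ∃ (j : Fin (N + 1)) (x : ℕ → K) (t : ℕ), (∀ i, h i * (h j)⁻¹ ∈ O) ∧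
      (∀ s, s < t → risoValid P O (risoStage P (Algebra.adjoin k (Set.range fun i => h i * (h j)⁻¹))
        ((List.range t).map fun _ => N) x s) N (x s)) ∧
      IsRegularLocalRing ↥(risoLoc O (risoStage P
        (Algebra.adjoin k (Set.range fun i => h i * (h j)⁻¹)) ((List.range t).map fun _ => N) x t)) :=
  stub_rcrHeightOneLU stub_rcrHeightOneStep stub_rcrHeightOneReach P N hP h hh hgen O hk j₀ hj₀ hdim

end Summit.ResolutionOfSingularities.ResolutionOfSingularities.Theorems

end
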